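import Summits.SmoothPoincare4.SmoothPoincare4.Theses.CylinderEntropy
import Summits.SmoothPoincare4.SmoothPoincare4.Theorems.CylinderEntropyThinCrossSectionExistsStubFunkHeckeVanishing
import Summits.SmoothPoincare4.SmoothPoincare4.Theorems.CylinderEntropyThinCrossSectionExistsStubZonalSphereIntegral
import Summits.SmoothPoincare4.SmoothPoincare4.Theorems.CylinderEntropyThinCrossSectionExistsStubSliceDensity
import HarnessLib

/-!
# `SliceCalibration` (route `CylinderEntropy`, support item stmt-SmoothPoincare4-7634): `λ_cyl(S⁴ × {0}) = 1`

The unit slice `slice₀ = {z ∈ ℝ⁶ | ∑_{i<5} zᵢ² = 1, z₅ = 0} = S⁴ × {0}` of the round cylinder `N = S⁴ × ℝ` has typed cylinder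
entropy exactly `1`:

* `≤ 1`: by the K-chain of line `ball-mass-slack` of the crux `ThinCrossSectionExists` (all three stubs are landed theorems:
  K1 `stub_funkHeckeVanishing` — Funk–Hecke vanishing of the `k ≥ 1` Gegenbauer modes on `S⁴`, p96785;
  K2 `stub_zonalSphereIntegral` — the zonal heat series has total mass `μHE⁴(S⁴)`, p97290;
  K3 `stub_sliceDensity` — the typed density of the slice is `F̂_{p,τ}(slice₀) = e^{-p₅²/4τ}`, p96858),
  so every value under the supremum is `e^{-p₅²/4τ} ≤ 1` (`cylDensity_slice₀_eq`, `cylEntropy_slice₀_le_one`);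
* `≥ 1`: the `τ → ∞` end of the supremum centred on the slice (tree
  `Literature.Geometry.Riemannian.SphericalCylinderEntropy.one_le_cylEntropy_slice`).

`SliceCalibration_proof` has literally the type of the route decl `CylinderEntropy.SliceCalibration` (which unfolds to
`cylEntropy slice₀ = 1` definitionally).  Consequences for the crux chain of E = `ThinCrossSectionExists` (7633):
the sandwich `SPC4 ⇒ E` (`Negative.crux_of_spc4`), `μ(S⁴) = 1`, and the line's reduction `E ⇐ D`
(`thinCrossSectionExists_of_massSlackIntr`, which takes `λ_cyl(slice₀) ≤ 1`) lose their calibration hypothesis.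
Pure logic over landed files; no definitions, no facts.  Seat: prover-line-stmt-SmoothPoincare4-7633-c1-0.
-/

noncomputable section

open scoped BigOperators Topology ENNReal NNReal MeasureTheory
open Set Function MeasureTheory
open Literature.Geometry.Riemannian.SphericalCylinderEntropy (cylEntropy cylDensity one_le_cylEntropy_slice)
open Literature.Geometry.Manifold.CylinderSlice (range_sliceMap)

set_option linter.dupNamespace false

namespace Summit.SmoothPoincare4.SmoothPoincare4.Theorems

open Summit.SmoothPoincare4.SmoothPoincare4.Theses.CylinderEntropy (SliceCalibration)
open ThinCrossSectionExists.BallMassSlack (stub_funkHeckeVanishing stub_zonalSphereIntegral stub_sliceDensity)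

/-- **The typed density of the unit slice** at a centre `p ∈ N` and scale `τ > 0` is the Gaussian height factor
`F̂_{p,τ}(S⁴ × {0}) = e^{-p₅²/4τ}` (K1 → K2 → K3 composed; all three landed). [folklore] -/
theorem cylDensity_slice₀_eq {p : EuclideanSpace ℝ (Fin 6)} (hp : ∑ i : Fin 5, p (Fin.castSucc i) ^ 2 = 1)
    {τ : ℝ} (hτ : 0 < τ) :
    cylDensity {z : EuclideanSpace ℝ (Fin 6) | ∑ i : Fin 5, z (Fin.castSucc i) ^ 2 = 1 ∧ z 5 = 0} p τ =
      ENNReal.ofReal (Real.exp (-((p 5) ^ 2) / (4 * τ))) :=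
  stub_sliceDensity (stub_zonalSphereIntegral stub_funkHeckeVanishing) p hp τ hτ

/-- **`λ_cyl(S⁴ × {0}) ≤ 1`**: every value under the supremum is `e^{-p₅²/4τ} ≤ 1`. [folklore] -/
theorem cylEntropy_slice₀_le_one :
    cylEntropy {z : EuclideanSpace ℝ (Fin 6) | ∑ i : Fin 5, z (Fin.castSucc i) ^ 2 = 1 ∧ z 5 = 0} ≤ 1 := by
  refine iSup₂_le fun p hp => iSup₂_le fun τ hτ => ?_
  rw [cylDensity_slice₀_eq hp hτ]
  refine ENNReal.ofReal_le_one.2 (Real.exp_le_one_iff.2 ?_)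
  exact div_nonpos_of_nonpos_of_nonneg (neg_nonpos.2 (sq_nonneg _)) (by positivity)

/-- **`SliceCalibration` (item stmt-SmoothPoincare4-7634) holds: `λ_cyl(S⁴ × {0}) = 1` as typed** — `≤ 1` by the K-chain
(Funk–Hecke: only the `k = 0` Gegenbauer mode survives integration over `S⁴`, and the Gaussian height factor is `≤ 1`),
`≥ 1` by the large-scale limit `one_le_cylEntropy_slice`. [folklore] -/
theorem SliceCalibration_proof : SliceCalibration := by
  show cylEntropy {z : EuclideanSpace ℝ (Fin 6) | ∑ i : Fin 5, z (Fin.castSucc i) ^ 2 = 1 ∧ z 5 = 0} = 1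
  refine le_antisymm cylEntropy_slice₀_le_one ?_
  have h := one_le_cylEntropy_slice 0
  rwa [range_sliceMap] at h

end Summit.SmoothPoincare4.SmoothPoincare4.Theorems

end
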